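import Summits.Ventures.YMGap.RobustBall.HeatBathConcentrationDLR
import Summits.Ventures.YMGap.RobustBall.TiltedCovariance
import HarnessLib

/-!
# Robust ball (Y2) — SELF-AVERAGING OF THE PLAQUETTE (ACTION) DENSITY IN EVERY INFINITE-VOLUME GIBBS STATE of strong-coupling lattice Yang–Mills,
# with explicit stretched-exponential tails in the number of plaquettes

HONEST FRAMING: venture file of the cell `pub-ymgap` (QuantumFields programme), track ROBUST-BALL, seat rb-p2 (g14); the ENERGY cell of `HeatBathConcentrationDLR.lean`
(exponential concentration of local observables in every Gibbs state, from the heat-bath Poincaré inequality of every DLR state).  LATTICE statements at STRONG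
COUPLING for the DLR states `μ ∈ 𝒢(γ)` of the Wilson specification of `SU(N)` on `ℤ^d` ('t Hooft `β`, bare `Nβ`); Wilson action (class K); nothing about
`β → ∞`, the continuum or Clay.  The infinite-volume, every-Gibbs-state, exponential-tail companion of rb-p2 g11's torus cell `EnergyConcentrationBall`
(McDiarmid/Gaussian tails on the torus ball, inside the robust door).
* `isLipschitzCylinder_plaquetteAverage` — the plaquette average `A_P = |P|⁻¹ ∑_{p ∈ P} (1/N) Re tr U_p` over ANY non-empty finite set `P` of plaquettes is a
  Lipschitz cylinder on the links of `P`;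
* `abs_plaquetteAverage_sub_update_le` — its oscillation in the link `x` is `≤ 2 n_x/|P|`, `n_x = #{p ∈ P : x ∈ ∂p}`; `sum_sq_osc_plaquetteAverage_le` —
  `∑_x (2 n_x/|P|)² ≤ 32(d−1)/|P|` (`n_x ≤ 2(d−1)`, `∑_x n_x ≤ 4|P|`);
* ★★★ `gibbs_plaquetteAverage_deviation_le_of_oneLinkKRModulus` — KR window `2(d−1)|β| ≤ R`, `OneLinkKRModulus N R K`, `6(d−1)|β|K ≤ c < 1`: for EVERY DLR
  state `μ`, EVERY non-empty finite plaquette set `P` and every `r ≥ 0`,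
  `μ{|A_P − E_μ A_P| ≥ r} ≤ 2e^{2/3} exp(−r √((1 − c)|P| / (32(d−1))))` — the action density over any `|P|` plaquettes (no shape condition) is self-averaging in
  every infinite-volume Gibbs state, with tails stretched-exponential in `|P|`;
* ★★ `gibbs_variance_plaquetteAverage_le_of_oneLinkKRModulus` ∕ `su2_gibbs_variance_plaquetteAverage_le` — the `L²` form: `Var_μ(A_P) ≤ 16(d−1)/((1 − c)|P|)`
  (`SU(2)`, `d = 4`: `96/((2 − 9β_W)|P|)`) in every Gibbs state;
* ★★★ `su2_gibbs_plaquetteAverage_deviation_le` — `SU(2)`, `d = 4`, HYPOTHESIS-FREE on `0 ≤ β_W < 2/9` (tree coupling `β_W/2`):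
  `μ{|A_P − E_μ A_P| ≥ r} ≤ 2e^{2/3} exp(−r √((1 − 9β_W/2)|P|/96))` for every DLR state of 4D `SU(2)` lattice Yang–Mills.
PRIOR ART IN THE TREE (say so when quoting): ds-3's GAUSSIAN concentration column (`ConcentrationKR`, `ConcentrationLatticeSums`, `ConcentrationBall`,
`ConcentrationTorus`; Külske–McDiarmid through the single-link Dobrushin door) gives, for TRANSLATES of one local observable over `#B` sites, Gaussian tails
`2 exp(−2a²#B/v)` in every DLR state inside the PAIR door (SU(2), d = 4: `β_W < 1/6` hyp-free; Wilson cell up to `1/12`).  The present file is the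
Poincaré ∕ Aida–Stroock route: EXPONENTIAL (not Gaussian) tails, but on the larger KR window (`β_W < 2/9`), for ARBITRARY finite plaquette sets (no translate
structure) and with the explicit `ℓ²` oscillation norm; neither statement implies the other.
0 sorry, 0 definitions.  References: S. Aida, D. Stroock, Math. Res. Lett. 1 (1994) 75; C. Külske, CMP 239 (2003) 29; M. Ledoux (AMS 2001) §3.1.
Everything here is proved. [folklore]
-/

noncomputable section

open MeasureTheory Function Real Finset ProbabilityTheory Filter Topology
open scoped NNReal
open Summit.QuantumFields.YangMills.Theorems.StrongPinningPoincare
open Literature.Probability.LatticeModels Literature.Probability.LatticeModels.DobrushinMetric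
open Literature.MathematicalPhysics.QuantumLattice hiding torusNorm
open Literature.MathematicalPhysics.QuantumFieldTheory hiding ZdEdge Site
open Literature.MathematicalPhysics.QuantumFieldTheory.Balaban1983to89.StrongCouplingDobrushinWindow (OneLinkKRModulus)

namespace Summit.Ventures.YMGap.RobustBall.HeatBathConcentration

variable {d N : ℕ}

/-! ### The plaquette average over a finite set of plaquettes -/

section Average

/-- `|(1/N) Re tr U_p| ≤ 1`. [folklore] -/
theorem abs_plaquetteObs_le_one (p : ZdPlaquette d) (U : LGConfig d (Matrix.specialUnitaryGroup (Fin N) ℂ)) :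
    |zdPlaquetteObs (d := d) (fundamentalRep (Fin N)) p.1 p.2.1.1 p.2.1.2 U| ≤ 1 :=
  abs_zdPlaquetteObs_le (fun g => fundamentalRep_mem_unitaryGroup g) _ _ _ U

/-- **The plaquette average is a Lipschitz cylinder** on the links of its plaquettes (constant `4N³`). [folklore] -/
theorem isLipschitzCylinder_plaquetteAverage (P : Finset (ZdPlaquette d)) :
    IsLipschitzCylinder (fundamentalRep (Fin N))
      (fun U => (P.card : ℝ)⁻¹ * ∑ p ∈ P, zdPlaquetteObs (d := d) (fundamentalRep (Fin N)) p.1 p.2.1.1 p.2.1.2 U)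
      (P.biUnion plaquetteEdges) (4 * (N : ℝ≥0) ^ 3) := by
  classical
  set S := P.biUnion plaquetteEdges with hS
  refine ZdSmoothing.isLipschitzCylinder_of_dist_le fun U V => ?_
  set δ := dist (fun e : ↥S => suEntries (U e)) (fun e : ↥S => suEntries (V e)) with hδ
  have hterm : ∀ p ∈ P, |zdPlaquetteObs (d := d) (fundamentalRep (Fin N)) p.1 p.2.1.1 p.2.1.2 U -
      zdPlaquetteObs (d := d) (fundamentalRep (Fin N)) p.1 p.2.1.1 p.2.1.2 V| ≤ (4 * (N : ℝ≥0) ^ 3 : ℝ≥0) * δ := by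
    intro p hp
    have hL := isLipschitzCylinder_zdPlaquetteObs (N := N) (d := d) p.1 (i := p.2.1.1) (j := p.2.1.2) p.2.2
    obtain ⟨f, hf, hF⟩ := hL.exists_suEntries
    rw [hF, hF, ← Real.dist_eq]
    refine (hf.dist_le_mul _ _).trans (mul_le_mul_of_nonneg_left ?_ (by positivity))
    exact CouplingResponse.dist_restrict_le (Finset.subset_biUnion_of_mem plaquetteEdges hp) U V
  by_cases hP : P.card = 0
  · rw [Finset.card_eq_zero.1 hP]; simp; positivity
  have hPpos : (0 : ℝ) < P.card := by exact_mod_cast Nat.pos_of_ne_zero hP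
  rw [← mul_sub, ← Finset.sum_sub_distrib, abs_mul, abs_inv, abs_of_pos hPpos]
  calc (P.card : ℝ)⁻¹ * |∑ p ∈ P, (zdPlaquetteObs (d := d) (fundamentalRep (Fin N)) p.1 p.2.1.1 p.2.1.2 U -
        zdPlaquetteObs (d := d) (fundamentalRep (Fin N)) p.1 p.2.1.1 p.2.1.2 V)|
      ≤ (P.card : ℝ)⁻¹ * ∑ p ∈ P, (4 * (N : ℝ≥0) ^ 3 : ℝ≥0) * δ :=
        mul_le_mul_of_nonneg_left ((Finset.abs_sum_le_sum_abs _ _).trans (Finset.sum_le_sum hterm)) (by positivity)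
    _ = (4 * (N : ℝ≥0) ^ 3 : ℝ≥0) * δ := by
        rw [Finset.sum_const, nsmul_eq_mul, ← mul_assoc, inv_mul_cancel₀ hPpos.ne', one_mul]

/-- **Link oscillation of the plaquette average**: changing the link `x` moves `A_P` by at most `2 n_x/|P|`, `n_x = #{p ∈ P : x ∈ ∂p}`. [folklore] -/
theorem abs_plaquetteAverage_sub_update_le (P : Finset (ZdPlaquette d)) (x : ZdEdge d)
    (U : LGConfig d (Matrix.specialUnitaryGroup (Fin N) ℂ)) (s : Matrix.specialUnitaryGroup (Fin N) ℂ) :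
    |(P.card : ℝ)⁻¹ * ∑ p ∈ P, zdPlaquetteObs (d := d) (fundamentalRep (Fin N)) p.1 p.2.1.1 p.2.1.2 U -
        (P.card : ℝ)⁻¹ * ∑ p ∈ P, zdPlaquetteObs (d := d) (fundamentalRep (Fin N)) p.1 p.2.1.1 p.2.1.2 (update U x s)| ≤
      2 * ((P.filter fun p => x ∈ plaquetteEdges p).card : ℝ) / P.card := by
  classical
  by_cases hP : P.card = 0
  · rw [Finset.card_eq_zero.1 hP]; simp
  have hPpos : (0 : ℝ) < P.card := by exact_mod_cast Nat.pos_of_ne_zero hP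
  have hterm : ∀ p ∈ P, |zdPlaquetteObs (d := d) (fundamentalRep (Fin N)) p.1 p.2.1.1 p.2.1.2 U -
      zdPlaquetteObs (d := d) (fundamentalRep (Fin N)) p.1 p.2.1.1 p.2.1.2 (update U x s)| ≤
        if x ∈ plaquetteEdges p then 2 else 0 := by
    intro p _
    split_ifs with hx
    · calc _ ≤ |zdPlaquetteObs (d := d) (fundamentalRep (Fin N)) p.1 p.2.1.1 p.2.1.2 U| +
            |zdPlaquetteObs (d := d) (fundamentalRep (Fin N)) p.1 p.2.1.1 p.2.1.2 (update U x s)| := abs_sub _ _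
        _ ≤ 1 + 1 := add_le_add (abs_plaquetteObs_le_one p U) (abs_plaquetteObs_le_one p _)
        _ = 2 := by norm_num
    · have hdep := (isLipschitzCylinder_zdPlaquetteObs (N := N) (d := d) p.1 (i := p.2.1.1) (j := p.2.1.2) p.2.2).dependsOn
      have heq : zdPlaquetteObs (d := d) (fundamentalRep (Fin N)) p.1 p.2.1.1 p.2.1.2 (update U x s) =
          zdPlaquetteObs (d := d) (fundamentalRep (Fin N)) p.1 p.2.1.1 p.2.1.2 U :=
        hdep fun e (he : e ∈ (↑(plaquetteEdges p) : Set (ZdEdge d))) => update_of_ne (fun h => hx (by rw [← h]; exact Finset.mem_coe.1 he)) _ _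
      rw [heq, sub_self, abs_zero]
  rw [← mul_sub, ← Finset.sum_sub_distrib, abs_mul, abs_inv, abs_of_pos hPpos]
  calc (P.card : ℝ)⁻¹ * |∑ p ∈ P, (zdPlaquetteObs (d := d) (fundamentalRep (Fin N)) p.1 p.2.1.1 p.2.1.2 U -
        zdPlaquetteObs (d := d) (fundamentalRep (Fin N)) p.1 p.2.1.1 p.2.1.2 (update U x s))|
      ≤ (P.card : ℝ)⁻¹ * ∑ p ∈ P, (if x ∈ plaquetteEdges p then (2 : ℝ) else 0) :=
        mul_le_mul_of_nonneg_left ((Finset.abs_sum_le_sum_abs _ _).trans (Finset.sum_le_sum hterm)) (by positivity)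
    _ = 2 * ((P.filter fun p => x ∈ plaquetteEdges p).card : ℝ) / P.card := by
        rw [Finset.sum_ite, Finset.sum_const_zero, add_zero, Finset.sum_const, nsmul_eq_mul]
        field_simp

/-- **`∑_x (2 n_x/|P|)² ≤ 32(d−1)/|P|`** over the links of `P` (`n_x ≤ 2(d−1)` plaquettes through a link, `∑_x n_x ≤ 4|P|`). [folklore] -/
theorem sum_sq_osc_plaquetteAverage_le {P : Finset (ZdPlaquette d)} (hP : P.Nonempty) :
    ∑ x ∈ P.biUnion plaquetteEdges, (2 * ((P.filter fun p => x ∈ plaquetteEdges p).card : ℝ) / P.card) ^ 2 ≤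
      32 * ((d : ℝ) - 1) / P.card := by
  classical
  set S := P.biUnion plaquetteEdges with hS
  set n : ZdEdge d → ℕ := fun x => (P.filter fun p => x ∈ plaquetteEdges p).card with hn
  have hPpos : (0 : ℝ) < P.card := by exact_mod_cast hP.card_pos
  have hd1 : 1 ≤ d := by
    obtain ⟨p, _⟩ := hP
    exact Nat.one_le_of_lt p.2.1.2.isLt
  -- `n_x ≤ 2(d−1)`
  have hnle : ∀ x, (n x : ℝ) ≤ 2 * ((d : ℝ) - 1) := fun x => by
    have h1 : n x ≤ (plaquettesTouching {x}).card := by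
      refine Finset.card_le_card fun p hp => ?_
      rw [mem_plaquettesTouching_iff]
      exact ⟨x, Finset.mem_inter.2 ⟨(Finset.mem_filter.1 hp).2, Finset.mem_singleton_self x⟩⟩
    have h2 := card_plaquettesTouching_singleton_le x
    have h3 : ((2 * (d - 1) : ℕ) : ℝ) = 2 * ((d : ℝ) - 1) := by push_cast [Nat.cast_sub hd1]; ring
    rw [← h3]; exact_mod_cast h1.trans h2
  -- `∑_x n_x ≤ 4|P|` (double counting: each plaquette has at most four links)
  have hsum : ∑ x ∈ S, (n x : ℝ) ≤ 4 * P.card := by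
    have h1 : ∀ x, n x = ∑ p ∈ P, if x ∈ plaquetteEdges p then 1 else 0 := fun x => by
      rw [hn]; exact Finset.card_filter _ _
    have h2 : ∑ x ∈ S, (n x : ℝ) = ∑ p ∈ P, ∑ x ∈ S, if x ∈ plaquetteEdges p then (1 : ℝ) else 0 := by
      rw [Finset.sum_comm]
      refine Finset.sum_congr rfl fun x _ => ?_
      rw [h1 x]; push_cast; rfl
    have h3 : ∀ p ∈ P, ∑ x ∈ S, (if x ∈ plaquetteEdges p then (1 : ℝ) else 0) ≤ 4 := fun p hp => by
      rw [Finset.sum_ite, Finset.sum_const_zero, add_zero, Finset.sum_const, nsmul_eq_mul, mul_one]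
      have hsub : S.filter (fun x => x ∈ plaquetteEdges p) ⊆ plaquetteEdges p := fun x hx => (Finset.mem_filter.1 hx).2
      exact_mod_cast (Finset.card_le_card hsub).trans (card_plaquetteEdges_le p)
    rw [h2]
    calc ∑ p ∈ P, ∑ x ∈ S, (if x ∈ plaquetteEdges p then (1 : ℝ) else 0) ≤ ∑ _p ∈ P, (4 : ℝ) := Finset.sum_le_sum h3
      _ = 4 * P.card := by rw [Finset.sum_const, nsmul_eq_mul, mul_comm]
  have hd0 : (0 : ℝ) ≤ (d : ℝ) - 1 := by
    have : (1 : ℝ) ≤ d := by exact_mod_cast hd1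
    linarith
  -- termwise `(2 n_x/|P|)² ≤ 8(d−1) n_x / |P|²`
  have hterm : ∀ x ∈ S, (2 * (n x : ℝ) / P.card) ^ 2 ≤ 8 * ((d : ℝ) - 1) / (P.card : ℝ) ^ 2 * n x := fun x _ => by
    rw [div_pow, mul_pow]
    have hn0 : (0 : ℝ) ≤ n x := Nat.cast_nonneg _
    have : (2 : ℝ) ^ 2 * (n x : ℝ) ^ 2 ≤ 8 * ((d : ℝ) - 1) * n x := by nlinarith [hnle x]
    calc (2 : ℝ) ^ 2 * (n x : ℝ) ^ 2 / (P.card : ℝ) ^ 2 ≤ 8 * ((d : ℝ) - 1) * n x / (P.card : ℝ) ^ 2 :=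
          div_le_div_of_nonneg_right this (by positivity)
      _ = 8 * ((d : ℝ) - 1) / (P.card : ℝ) ^ 2 * n x := by ring
  calc ∑ x ∈ S, (2 * (n x : ℝ) / P.card) ^ 2 ≤ ∑ x ∈ S, 8 * ((d : ℝ) - 1) / (P.card : ℝ) ^ 2 * n x := Finset.sum_le_sum hterm
    _ = 8 * ((d : ℝ) - 1) / (P.card : ℝ) ^ 2 * ∑ x ∈ S, (n x : ℝ) := by rw [Finset.mul_sum]
    _ ≤ 8 * ((d : ℝ) - 1) / (P.card : ℝ) ^ 2 * (4 * P.card) := mul_le_mul_of_nonneg_left hsum (by positivity)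
    _ = 32 * ((d : ℝ) - 1) / P.card := by field_simp; ring

/-- The oscillation square-sum of the plaquette average is positive for a non-empty `P`. [folklore] -/
theorem sum_sq_osc_plaquetteAverage_pos {P : Finset (ZdPlaquette d)} (hP : P.Nonempty) :
    0 < ∑ x ∈ P.biUnion plaquetteEdges, (2 * ((P.filter fun p => x ∈ plaquetteEdges p).card : ℝ) / P.card) ^ 2 := by
  classical
  obtain ⟨p, hp⟩ := hP
  have hPpos : (0 : ℝ) < P.card := by exact_mod_cast Finset.card_pos.2 ⟨p, hp⟩
  set x : ZdEdge d := (p.1, p.2.1.1) with hx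
  have hxp : x ∈ plaquetteEdges p := by simp [hx, plaquetteEdges]
  have hxS : x ∈ P.biUnion plaquetteEdges := Finset.mem_biUnion.2 ⟨p, hp, hxp⟩
  have hnx : 1 ≤ (P.filter fun q => x ∈ plaquetteEdges q).card := Finset.card_pos.2 ⟨p, Finset.mem_filter.2 ⟨hp, hxp⟩⟩
  refine lt_of_lt_of_le ?_ (Finset.single_le_sum (fun y _ => sq_nonneg _) hxS)
  have : (1 : ℝ) ≤ (P.filter fun q => x ∈ plaquetteEdges q).card := by exact_mod_cast hnx
  positivity

end Average

/-! ### Self-averaging of the action density in every Gibbs state -/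

section Gibbs

/-- Two-sided tail from the one-sided tails. [folklore] -/
theorem measureReal_abs_ge_le_of_tails {Ω : Type*} [MeasurableSpace Ω] (μ : Measure Ω) [IsFiniteMeasure μ] {g : Ω → ℝ} {r B : ℝ}
    (hup : μ.real {ω | r ≤ g ω} ≤ B) (hdown : μ.real {ω | g ω ≤ -r} ≤ B) : μ.real {ω | r ≤ |g ω|} ≤ 2 * B := by
  have hsub : {ω | r ≤ |g ω|} ⊆ {ω | r ≤ g ω} ∪ {ω | g ω ≤ -r} := by
    intro ω hω
    simp only [Set.mem_setOf_eq, Set.mem_union] at hω ⊢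
    rcases le_or_gt 0 (g ω) with h | h
    · left; rwa [abs_of_nonneg h] at hω
    · right; rw [abs_of_neg h] at hω; linarith
  calc μ.real {ω | r ≤ |g ω|} ≤ μ.real ({ω | r ≤ g ω} ∪ {ω | g ω ≤ -r}) := measureReal_mono hsub
    _ ≤ μ.real {ω | r ≤ g ω} + μ.real {ω | g ω ≤ -r} := measureReal_union_le _ _
    _ ≤ 2 * B := by linarith

/-- Monotonicity of the tail bound in the rate constant: `κ ≤ κ'`, `r ≥ 0` ⇒ `e^{−r/√κ} ≤ e^{−r √(1/κ')}`. [folklore] -/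
theorem exp_neg_div_sqrt_le {κ κ' r : ℝ} (hκ : 0 < κ) (hle : κ ≤ κ') (hr : 0 ≤ r) :
    Real.exp (-r / Real.sqrt κ) ≤ Real.exp (-(r * Real.sqrt κ'⁻¹)) := by
  rw [Real.exp_le_exp]
  have hq : Real.sqrt κ'⁻¹ ≤ (Real.sqrt κ)⁻¹ := by
    rw [← Real.sqrt_inv]
    exact Real.sqrt_le_sqrt ((inv_le_inv₀ (lt_of_lt_of_le hκ hle) hκ).2 hle)
  have : r * Real.sqrt κ'⁻¹ ≤ r / Real.sqrt κ := by
    rw [div_eq_mul_inv]; exact mul_le_mul_of_nonneg_left hq hr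
  rw [neg_div]
  exact neg_le_neg this

/-- ★★★ **SELF-AVERAGING OF THE PLAQUETTE DENSITY IN EVERY INFINITE-VOLUME GIBBS STATE** (`SU(N)` on `ℤ^d`, 't Hooft `β`, bare `Nβ`): on the KR window
`2(d−1)|β| ≤ R`, `OneLinkKRModulus N R K`, `6(d−1)|β|K ≤ c < 1`, for EVERY DLR state `μ`, EVERY non-empty finite set `P` of plaquettes and every `r ≥ 0`, the
plaquette average `A_P = |P|⁻¹ ∑_{p∈P} (1/N) Re tr U_p` satisfies `μ{|A_P − E_μ A_P| ≥ r} ≤ 2e^{2/3} exp(−r √((1 − c)|P|/(32(d−1))))`. [folklore] -/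
theorem gibbs_plaquetteAverage_deviation_le_of_oneLinkKRModulus (hd : 2 ≤ d) (hN : 1 ≤ N) {β R K c : ℝ} (hK : 0 ≤ K)
    (hR : |β| * (2 * ((d : ℝ) - 1)) ≤ R) (hmod : OneLinkKRModulus N R K) (hc : 6 * ((d : ℝ) - 1) * |β| * K ≤ c) (hc1 : c < 1)
    {μ : Measure (LGConfig d (Matrix.specialUnitaryGroup (Fin N) ℂ))}
    (hμ : μ ∈ ymGibbsMeasures (d := d) (fundamentalRep (Fin N)) (N * β))
    {P : Finset (ZdPlaquette d)} (hP : P.Nonempty) {r : ℝ} (hr : 0 ≤ r) :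
    μ.real {U | r ≤ |(P.card : ℝ)⁻¹ * ∑ p ∈ P, zdPlaquetteObs (d := d) (fundamentalRep (Fin N)) p.1 p.2.1.1 p.2.1.2 U -
        ∫ U', (P.card : ℝ)⁻¹ * ∑ p ∈ P, zdPlaquetteObs (d := d) (fundamentalRep (Fin N)) p.1 p.2.1.1 p.2.1.2 U' ∂μ|} ≤
      2 * (Real.exp (2 / 3) * Real.exp (-(r * Real.sqrt ((32 * ((d : ℝ) - 1) / ((1 - c) * P.card))⁻¹)))) := by
  classical
  haveI : SecondCountableTopology (Matrix (Fin N) (Fin N) ℂ) := inferInstanceAs (SecondCountableTopology (Fin N → Fin N → ℂ))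
  haveI : SecondCountableTopology (Matrix.specialUnitaryGroup (Fin N) ℂ) := Topology.IsEmbedding.subtypeVal.secondCountableTopology
  have hμ' : IsGibbsMeasure (ymSpecification (d := d) (fundamentalRep (Fin N)) (N * β)) μ := hμ
  haveI := hμ'.isProbabilityMeasure
  have hd1 : 1 ≤ d := by omega
  have hd0 : (0 : ℝ) < (d : ℝ) - 1 := by
    have : (2 : ℝ) ≤ d := by exact_mod_cast hd
    linarith
  have hPpos : (0 : ℝ) < P.card := by exact_mod_cast hP.card_pos
  have hc0 : 0 < 1 - c := by linarith
  have hF := isLipschitzCylinder_plaquetteAverage (N := N) (d := d) P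
  have hoscA : ∀ x ∈ P.biUnion plaquetteEdges, ∀ (U : LGConfig d (Matrix.specialUnitaryGroup (Fin N) ℂ)) (s : Matrix.specialUnitaryGroup (Fin N) ℂ),
      |(P.card : ℝ)⁻¹ * ∑ p ∈ P, zdPlaquetteObs (d := d) (fundamentalRep (Fin N)) p.1 p.2.1.1 p.2.1.2 U -
        (P.card : ℝ)⁻¹ * ∑ p ∈ P, zdPlaquetteObs (d := d) (fundamentalRep (Fin N)) p.1 p.2.1.1 p.2.1.2 (update U x s)| ≤
        2 * ((P.filter fun p => x ∈ plaquetteEdges p).card : ℝ) / P.card := fun x _ U s => abs_plaquetteAverage_sub_update_le P x U s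
  have hD := sum_sq_osc_plaquetteAverage_pos (d := d) hP
  have hup := gibbs_measureReal_deviation_ge_le_of_oneLinkKRModulus hd1 hN hK hR hmod hc hc1 hμ hF _ hoscA hD r
  have hdown := gibbs_measureReal_deviation_le_le_of_oneLinkKRModulus hd1 hN hK hR hmod hc hc1 hμ hF _ hoscA hD r
  -- compare the rates: `2(2(1−c))⁻¹ ∑ δ² ≤ 32(d−1)/((1−c)|P|)`
  have hκpos : 0 < 2 * (2 * (1 - c))⁻¹ * ∑ x ∈ P.biUnion plaquetteEdges, (2 * ((P.filter fun p => x ∈ plaquetteEdges p).card : ℝ) / P.card) ^ 2 := by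
    positivity
  have hκle : 2 * (2 * (1 - c))⁻¹ * ∑ x ∈ P.biUnion plaquetteEdges, (2 * ((P.filter fun p => x ∈ plaquetteEdges p).card : ℝ) / P.card) ^ 2 ≤
      32 * ((d : ℝ) - 1) / ((1 - c) * P.card) := by
    have h1 := sum_sq_osc_plaquetteAverage_le (d := d) hP
    calc _ = (1 - c)⁻¹ * ∑ x ∈ P.biUnion plaquetteEdges, (2 * ((P.filter fun p => x ∈ plaquetteEdges p).card : ℝ) / P.card) ^ 2 := by
          field_simp
      _ ≤ (1 - c)⁻¹ * (32 * ((d : ℝ) - 1) / P.card) := mul_le_mul_of_nonneg_left h1 (inv_nonneg.2 hc0.le)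
      _ = 32 * ((d : ℝ) - 1) / ((1 - c) * P.card) := by field_simp
  have hrate := exp_neg_div_sqrt_le hκpos hκle hr
  refine measureReal_abs_ge_le_of_tails μ (hup.trans ?_) (hdown.trans ?_) <;>
    exact mul_le_mul_of_nonneg_left hrate (Real.exp_pos _).le

/-- ★★★ **`SU(2)`, `d = 4`, HYPOTHESIS-FREE on `0 ≤ β_W < 2/9`** (tree coupling `β_W/2`, quarter modulus): for EVERY DLR state `μ` of 4D `SU(2)` lattice Yang–Mills,
EVERY non-empty finite plaquette set `P` and every `r ≥ 0`, the plaquette average `A_P = |P|⁻¹ ∑_{p∈P} ½ Re tr U_p` satisfies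
`μ{|A_P − E_μ A_P| ≥ r} ≤ 2e^{2/3} exp(−r √((1 − 9β_W/2)|P|/96))` — the action density is self-averaging in the infinite-volume strong-coupling state, with tails
stretched-exponential in the number of plaquettes, for plaquette sets of ANY shape. [folklore] -/
theorem su2_gibbs_plaquetteAverage_deviation_le {βW : ℝ} (h0 : 0 ≤ βW) (h : βW < 2 / 9)
    {μ : Measure (LGConfig 4 (Matrix.specialUnitaryGroup (Fin 2) ℂ))}
    (hμ : μ ∈ ymGibbsMeasures (d := 4) (fundamentalRep (Fin 2)) (βW / 2))
    {P : Finset (ZdPlaquette 4)} (hP : P.Nonempty) {r : ℝ} (hr : 0 ≤ r) :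
    μ.real {U | r ≤ |(P.card : ℝ)⁻¹ * ∑ p ∈ P, zdPlaquetteObs (d := 4) (fundamentalRep (Fin 2)) p.1 p.2.1.1 p.2.1.2 U -
        ∫ U', (P.card : ℝ)⁻¹ * ∑ p ∈ P, zdPlaquetteObs (d := 4) (fundamentalRep (Fin 2)) p.1 p.2.1.1 p.2.1.2 U' ∂μ|} ≤
      2 * (Real.exp (2 / 3) * Real.exp (-(r * Real.sqrt ((1 - 9 * βW / 2) * P.card / 96)))) := by
  have hβ : ((2 : ℕ) : ℝ) * (βW / 4) = βW / 2 := by push_cast; ring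
  have habs : |βW / 4| = βW / 4 := abs_of_nonneg (by positivity)
  have hμ4 : μ ∈ ymGibbsMeasures (d := 4) (fundamentalRep (Fin 2)) ((2 : ℕ) * (βW / 4)) := by rwa [hβ]
  have key := gibbs_plaquetteAverage_deviation_le_of_oneLinkKRModulus (d := 4) (N := 2) (by norm_num) (by norm_num) (β := βW / 4) (R := 3 * βW / 2)
    zero_le_one (by rw [habs]; norm_num; linarith) (SlabAreaLawDimensions.su2_oneLinkKRModulus_of_le_one (by linarith)) (c := 9 * βW / 2)
    (by rw [habs]; norm_num; linarith) (by linarith) hμ4 hP hr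
  have hPpos : (0 : ℝ) < P.card := by exact_mod_cast hP.card_pos
  have hc0 : 0 < 1 - 9 * βW / 2 := by linarith
  have e : (32 * (((4 : ℕ) : ℝ) - 1) / ((1 - 9 * βW / 2) * (P.card : ℝ)))⁻¹ = (1 - 9 * βW / 2) * P.card / 96 := by
    rw [inv_div]; push_cast; ring
  rw [e] at key
  exact key

/-- ★★ **THE VARIANCE OF THE PLAQUETTE DENSITY IS `O(1/|P|)` IN EVERY GIBBS STATE** (KR window, every `SU(N)`, `d ≥ 2`): for every DLR state `μ` and every non-empty
finite plaquette set `P`, `Var_μ(A_P) ≤ (2(1 − c))⁻¹ · 32(d−1)/|P| = 16(d−1)/((1 − c)|P|)` (the oscillation form of the heat-bath Poincaré inequality of the Gibbs state,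
`HeatBathPoincareZd.gibbsVariance_le_sum_osc_sq`) — the `L²` law of large numbers for the action density, with rate, in infinite volume. [folklore] -/
theorem gibbs_variance_plaquetteAverage_le_of_oneLinkKRModulus (hd : 2 ≤ d) (hN : 1 ≤ N) {β R K c : ℝ} (hK : 0 ≤ K)
    (hR : |β| * (2 * ((d : ℝ) - 1)) ≤ R) (hmod : OneLinkKRModulus N R K) (hc : 6 * ((d : ℝ) - 1) * |β| * K ≤ c) (hc1 : c < 1)
    {μ : Measure (LGConfig d (Matrix.specialUnitaryGroup (Fin N) ℂ))}
    (hμ : μ ∈ ymGibbsMeasures (d := d) (fundamentalRep (Fin N)) (N * β))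
    {P : Finset (ZdPlaquette d)} (hP : P.Nonempty) :
    ProbabilityTheory.variance (fun U => (P.card : ℝ)⁻¹ * ∑ p ∈ P, zdPlaquetteObs (d := d) (fundamentalRep (Fin N)) p.1 p.2.1.1 p.2.1.2 U) μ ≤
      (2 * (1 - c))⁻¹ * (32 * ((d : ℝ) - 1) / P.card) := by
  classical
  have hd1 : 1 ≤ d := by omega
  have hc0 : 0 < 2 * (1 - c) := by linarith
  have h := HeatBathPoincareZd.gibbsVariance_le_sum_osc_sq hd1 hN hK hR hmod hc hc1 hμ (isLipschitzCylinder_plaquetteAverage (N := N) (d := d) P)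
    (fun x => 2 * ((P.filter fun p => x ∈ plaquetteEdges p).card : ℝ) / P.card) (fun x U s => abs_plaquetteAverage_sub_update_le P x U s)
  exact h.trans (mul_le_mul_of_nonneg_left (sum_sq_osc_plaquetteAverage_le (d := d) hP) (inv_nonneg.2 hc0.le))

/-- ★★ **`SU(2)`, `d = 4`, `0 ≤ β_W < 2/9`**: `Var_μ(A_P) ≤ 96/((2 − 9β_W)|P|)` for every DLR state and every non-empty finite plaquette set `P`. [folklore] -/
theorem su2_gibbs_variance_plaquetteAverage_le {βW : ℝ} (h0 : 0 ≤ βW) (h : βW < 2 / 9)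
    {μ : Measure (LGConfig 4 (Matrix.specialUnitaryGroup (Fin 2) ℂ))}
    (hμ : μ ∈ ymGibbsMeasures (d := 4) (fundamentalRep (Fin 2)) (βW / 2)) {P : Finset (ZdPlaquette 4)} (hP : P.Nonempty) :
    ProbabilityTheory.variance (fun U => (P.card : ℝ)⁻¹ * ∑ p ∈ P, zdPlaquetteObs (d := 4) (fundamentalRep (Fin 2)) p.1 p.2.1.1 p.2.1.2 U) μ ≤
      96 / ((2 - 9 * βW) * P.card) := by
  have hβ : ((2 : ℕ) : ℝ) * (βW / 4) = βW / 2 := by push_cast; ring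
  have habs : |βW / 4| = βW / 4 := abs_of_nonneg (by positivity)
  have hμ4 : μ ∈ ymGibbsMeasures (d := 4) (fundamentalRep (Fin 2)) ((2 : ℕ) * (βW / 4)) := by rwa [hβ]
  have key := gibbs_variance_plaquetteAverage_le_of_oneLinkKRModulus (d := 4) (N := 2) (by norm_num) (by norm_num) (β := βW / 4) (R := 3 * βW / 2)
    zero_le_one (by rw [habs]; norm_num; linarith) (SlabAreaLawDimensions.su2_oneLinkKRModulus_of_le_one (by linarith)) (c := 9 * βW / 2)
    (by rw [habs]; norm_num; linarith) (by linarith) hμ4 hP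
  have hPpos : (0 : ℝ) < P.card := by exact_mod_cast hP.card_pos
  have hc0 : 0 < 2 - 9 * βW := by linarith
  have e : (2 * (1 - 9 * βW / 2))⁻¹ * (32 * (((4 : ℕ) : ℝ) - 1) / (P.card : ℝ)) = 96 / ((2 - 9 * βW) * P.card) := by
    push_cast; field_simp; ring
  rw [e] at key
  exact key

end Gibbs



end Summit.Ventures.YMGap.RobustBall.HeatBathConcentration

end
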